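import Summits.QuantumFields.YangMills.Theorems.BalabanUVNodesN11Sect3SupplyChainDefs
import Literature.MathematicalPhysics.QuantumFieldTheory.Balaban1983to89.Node00.Record13SepCoPHChi
import Literature.MathematicalPhysics.QuantumFieldTheory.Balaban1983to89.Node00.Record13ResidualsRChi
import Summits.QuantumFields.YangMills.Theorems.BalabanUVNodesN11HistoryPinnedResidualDefsChi
import Summits.QuantumFields.YangMills.Theorems.BalabanUVNodesN11RePinnedParamDefsChi
import Summits.QuantumFields.YangMills.Theorems.BalabanUVNodesN11NoExpansionAtRecord13CoPChi
import Summits.QuantumFields.YangMills.Theorems.BalabanUVNodesN11NoExpansionDiagonalCoPHChi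
import Summits.QuantumFields.YangMills.Theorems.BalabanUVNodesN11BackgroundScaleLocalChi
import Summits.QuantumFields.YangMills.Theorems.BalabanUVNodesN11Sect3SupplyPresentParentsChi
import Summits.QuantumFields.YangMills.Theorems.BalabanUVNodesN11NoExpansionOldFactorsChi
import Summits.QuantumFields.YangMills.Theorems.BalabanUVNodesN11NoExpansionGeneralStepCoPHOldBranchChi
import Summits.QuantumFields.YangMills.Theorems.BalabanUVNodesN11NoExpansionGeneralStepLawsCoPHChi
import Summits.QuantumFields.YangMills.Theorems.BalabanUVNodesN11NoExpansionGeneralStepGraphChi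
import Summits.QuantumFields.YangMills.Theorems.BalabanUVNodesN11DiagonalOldBranchMeasurableChi
import Summits.QuantumFields.YangMills.Theorems.BalabanUVNodesN11OldBranchPairChi
import Summits.QuantumFields.YangMills.Theorems.BalabanUVNodesN11TruncationDominationChi
import Summits.QuantumFields.YangMills.Theorems.BalabanUVNodesN11Sect3SupplySplicePairChi

/-!
# χ-GENERIC RE-ISSUE (WORK ORDER RC-1 «RE-CENTRE THE RECORD», director-ym №462 (B) ∕ №467 (D)) of `BalabanUVNodesN11Sect3SupplyChainDefs`

Cell `pub-ymgap` (HUMAN RULING D-0062, Track A), seat `pub-ymgap-dag-n11-d` (N11 [B14] s2; N11-σ campaign, `N11-G44-RC1-REACH-CENSUS.md`).  The CENTRE-TYPED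
declarations of `BalabanUVNodesN11Sect3SupplyChainDefs` (those whose statement reads the (2.9) cut-off centre through `gOfRecord₁₃ ∕ EOfRecord₁₃ ∕ Provisos₁₃… ∕ T∕SLaw₁₃… ∕
UbgOfRecord₁₃… ∕ WtOfRecord₁₃… ∕ datum∕tower∕coreOfRecord₁₃…`) RE-ISSUED VERBATIM in the β-slot `χ : ChiSlot F N` over [Ax-3b]∕[Ax-3c]∕[Ax-3d]'s χ-generic carriers
(`Node00/Record13Chi` ∕ `Record13CoPHChi` ∕ `Record13SepCoPHChi`): σ = (binder `(χ : ChiSlot F N)` after `θ`; Node00 defs `X ↦ XChi … χ`; Node00 rows `Y ↦ Y_chi`;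
this lane's sibling modules `…Chi` for Summits-side dependencies); SAME short names in the sibling namespace `…BalabanUVNodesN11Sect3SupplyChainDefsChi` (consumers switch by namespace);
the 2 centre-FREE declarations of the original are NOT copied — they are reused BY NAME (`open … (…)` below).  At `χ := chiβOfRecord₁₃ θ` every statement here is
DEFINITIONALLY the landed one ([Ax-3b]'s `rfl` receipts); at `χ := chiβOfRecord₁₃Ax θ` it is what the Ax-record's N11 machine reads.  Nothing of record edited (body-freeze №460 (2)).

HONEST FRAMING.  Count-neutral kernel re-elaboration of landed N11 bookkeeping∕estimates in a parameter; every HYPOTHESIS of the original stays a hypothesis; nothing of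
Bałaban asserted beyond what the original file proves; N11 NOT discharged; K-items untouched; counts unmoved.  One finite `𝕋⁴_{L^K}` programme at fixed `ε = L^{−K}` —
NOT ℝ⁴, NOT OS, NOT a mass gap, NOT Clay.  No `sorry`∕`instance`∕`notation`.  Sources: as the original module, plus [I] = [Balaban1987RG1] (2.9) p.266 (the cut-off's centre).
-/

noncomputable section

open MeasureTheory
open scoped BigOperators Matrix.Norms.L2Operator

namespace Summit.QuantumFields.YangMills.Theorems.BalabanUVNodesN11Sect3SupplyChainDefsChi

open Summit.QuantumFields.YangMills.Theorems.BalabanUVNodesN11Sect3SupplyChainDefs (chainWitness_zero chainWitness_succ)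
open Literature.MathematicalPhysics.QuantumFieldTheory.Balaban1983to89 T4Continuum Node00 Node00.Tk
open BalabanUVNodesN11Sect3SupplySpliceDefs
open BalabanUVNodesN11Sect3SupplySpliceOwnBoundary (graftAboveB graftAboveB_E)
open BalabanUVNodesN11FluctTruncationDefs (IsFluctLocal)
open BalabanUVNodesN11FluctTruncationChi (sLaw₁₃CoPH_iff_exists_local)

variable {F : T4Family} {N : ℕ} [NeZero N]
variable (θ : Stage13HParams F N) (χ : ChiSlot F N) (p : B12.RunParams)

/-! ## §1  The deterministic splice of the 𝐓-image witness -/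

section Splice

open Classical in
/-- **THE DETERMINISTIC SPLICE OF THE 𝐓-IMAGE TERM VALUES** at level `k` from the level-`k` witness `t` and the supplier's new terms `tnew` (history by history over the
length-`(k+1)` histories `s′`): at a NO-EXPANSION history (`Ω_{k+1}(s′) = ∅`) the old terms of `t (init s′)` with the universal new 𝐄 and no new `𝐑 ∕ 𝐁`
(`graftAbove k · (zeroRB ·)`, print (3.25)); at a 𝐓-ABSENT expansion child (`𝐓ρ_k(s′) ≡ 0`) the same with the old `𝐁^{(k)}` cut (`dropBFrom k`) — nothing is read there; at
a 𝐓-PRESENT expansion child `graftAboveB k (t (init s′)) (tnew s′)` — old `𝐄 ∕ 𝐑` at the levels `≤ k`, old `𝐁` below `k`, the supplier's `𝐁^{(k)}` and level-`(k+1)` terms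
([III] §3's construction). [cite: Balaban1988Convergent, §2 p.262, §3 p.279, (3.24)–(3.25) p.270, (3.1) p.264 (bookkeeping)] -/
def spliceTermsB (k : ℕ) (t : SeqOfRecord F θ.ν θ.τ9.M (gOfRecord₁₃Chi F N θ.toStage13Params χ p) p.K k → Sect2.TermValues (F.P p.K) (MatA N) (FluctV N) θ.τ9.M) (tnew : SeqOfRecord F θ.ν θ.τ9.M (gOfRecord₁₃Chi F N θ.toStage13Params χ p) p.K (k + 1) → Sect2.TermValues (F.P p.K) (MatA N) (FluctV N) θ.τ9.M) :
    SeqOfRecord F θ.ν θ.τ9.M (gOfRecord₁₃Chi F N θ.toStage13Params χ p) p.K (k + 1) → Sect2.TermValues (F.P p.K) (MatA N) (FluctV N) θ.τ9.M := fun s =>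
  if s.Ω (k + 1) = ∅ then graftAbove k (t s.init) (zeroRB (tnew s))
  else if slotsTOfRecord F N θ.ν θ.τ9 (EOfRecord₁₃Chi F N θ.toStage13Params χ) (wOfRecord₉ F N θ.toStage9Params) θ.ppSel p (gOfRecord₁₃Chi F N θ.toStage13Params χ p) (k + 1) s = 0 then graftAbove k (dropBFrom k (t s.init)) (zeroRB (tnew s))
  else graftAboveB k (t s.init) (tnew s)

open Classical in
/-- **THE DETERMINISTIC SPLICE OF THE CONSTANTS**: `E_{k+1}(s′) = E_k(init s′)` at a no-expansion history (print (3.25)), the supplier's `EkN s′` otherwise.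
[cite: Balaban1988Convergent, (3.25) p.270, (2.23) p.258 (bookkeeping)] -/
def spliceConst (k : ℕ) (Ek : SeqOfRecord F θ.ν θ.τ9.M (gOfRecord₁₃Chi F N θ.toStage13Params χ p) p.K k → ℝ) (EkN : SeqOfRecord F θ.ν θ.τ9.M (gOfRecord₁₃Chi F N θ.toStage13Params χ p) p.K (k + 1) → ℝ) : SeqOfRecord F θ.ν θ.τ9.M (gOfRecord₁₃Chi F N θ.toStage13Params χ p) p.K (k + 1) → ℝ := fun s =>
  if s.Ω (k + 1) = ∅ then Ek s.init else EkN s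

variable {θ χ p}

/-- At a no-expansion history the splice is `graftAbove k (t (init s′)) (zeroRB (tnew s′))`. [cite: Balaban1988Convergent, (3.25) p.270 (bookkeeping)] -/
theorem spliceTermsB_of_Omega_empty {k : ℕ} (t : SeqOfRecord F θ.ν θ.τ9.M (gOfRecord₁₃Chi F N θ.toStage13Params χ p) p.K k → Sect2.TermValues (F.P p.K) (MatA N) (FluctV N) θ.τ9.M) (tnew : SeqOfRecord F θ.ν θ.τ9.M (gOfRecord₁₃Chi F N θ.toStage13Params χ p) p.K (k + 1) → Sect2.TermValues (F.P p.K) (MatA N) (FluctV N) θ.τ9.M)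
    (s : SeqOfRecord F θ.ν θ.τ9.M (gOfRecord₁₃Chi F N θ.toStage13Params χ p) p.K (k + 1)) (hΩ : s.Ω (k + 1) = ∅) : spliceTermsB θ χ p k t tnew s = graftAbove k (t s.init) (zeroRB (tnew s)) := by
  unfold spliceTermsB; rw [if_pos hΩ]

/-- At a 𝐓-absent expansion child the splice is `graftAbove k (dropBFrom k (t (init s′))) (zeroRB (tnew s′))`. [cite: Balaban1988Convergent, (3.1) p.264, (3.24) p.270 (bookkeeping)] -/
theorem spliceTermsB_of_absent {k : ℕ} (t : SeqOfRecord F θ.ν θ.τ9.M (gOfRecord₁₃Chi F N θ.toStage13Params χ p) p.K k → Sect2.TermValues (F.P p.K) (MatA N) (FluctV N) θ.τ9.M) (tnew : SeqOfRecord F θ.ν θ.τ9.M (gOfRecord₁₃Chi F N θ.toStage13Params χ p) p.K (k + 1) → Sect2.TermValues (F.P p.K) (MatA N) (FluctV N) θ.τ9.M)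
    (s : SeqOfRecord F θ.ν θ.τ9.M (gOfRecord₁₃Chi F N θ.toStage13Params χ p) p.K (k + 1)) (hΩ : s.Ω (k + 1) ≠ ∅) (h0 : slotsTOfRecord F N θ.ν θ.τ9 (EOfRecord₁₃Chi F N θ.toStage13Params χ) (wOfRecord₉ F N θ.toStage9Params) θ.ppSel p (gOfRecord₁₃Chi F N θ.toStage13Params χ p) (k + 1) s = 0) :
    spliceTermsB θ χ p k t tnew s = graftAbove k (dropBFrom k (t s.init)) (zeroRB (tnew s)) := by
  unfold spliceTermsB; rw [if_neg hΩ, if_pos h0]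

/-- At a 𝐓-present expansion child the splice is `graftAboveB k (t (init s′)) (tnew s′)`. [cite: Balaban1988Convergent, §3 p.279 (bookkeeping)] -/
theorem spliceTermsB_of_present {k : ℕ} (t : SeqOfRecord F θ.ν θ.τ9.M (gOfRecord₁₃Chi F N θ.toStage13Params χ p) p.K k → Sect2.TermValues (F.P p.K) (MatA N) (FluctV N) θ.τ9.M) (tnew : SeqOfRecord F θ.ν θ.τ9.M (gOfRecord₁₃Chi F N θ.toStage13Params χ p) p.K (k + 1) → Sect2.TermValues (F.P p.K) (MatA N) (FluctV N) θ.τ9.M)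
    (s : SeqOfRecord F θ.ν θ.τ9.M (gOfRecord₁₃Chi F N θ.toStage13Params χ p) p.K (k + 1)) (hΩ : s.Ω (k + 1) ≠ ∅) (hT : slotsTOfRecord F N θ.ν θ.τ9 (EOfRecord₁₃Chi F N θ.toStage13Params χ) (wOfRecord₉ F N θ.toStage9Params) θ.ppSel p (gOfRecord₁₃Chi F N θ.toStage13Params χ p) (k + 1) s ≠ 0) :
    spliceTermsB θ χ p k t tnew s = graftAboveB k (t s.init) (tnew s) := by
  unfold spliceTermsB; rw [if_neg hΩ, if_neg hT]

/-- The 𝐄-component of the splice is `graftAbove`'s in every case (`zeroRB`, `dropBFrom`, `graftAboveB` do not touch 𝐄). [cite: Balaban1988Convergent, (2.25)–(2.27) p.259 (bookkeeping)] -/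
theorem spliceTermsB_E {k : ℕ} (t : SeqOfRecord F θ.ν θ.τ9.M (gOfRecord₁₃Chi F N θ.toStage13Params χ p) p.K k → Sect2.TermValues (F.P p.K) (MatA N) (FluctV N) θ.τ9.M) (tnew : SeqOfRecord F θ.ν θ.τ9.M (gOfRecord₁₃Chi F N θ.toStage13Params χ p) p.K (k + 1) → Sect2.TermValues (F.P p.K) (MatA N) (FluctV N) θ.τ9.M) (s : SeqOfRecord F θ.ν θ.τ9.M (gOfRecord₁₃Chi F N θ.toStage13Params χ p) p.K (k + 1)) :
    (spliceTermsB θ χ p k t tnew s).E = (graftAbove k (t s.init) (tnew s)).E := by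
  unfold spliceTermsB; split_ifs <;> rfl

/-- **THE SPLICE IS UNIVERSAL IN 𝐄** when `t` and `tnew` are. [cite: Balaban1988Convergent, (2.25)–(2.27) p.259 (bookkeeping)] -/
theorem universalE_spliceTermsB {k : ℕ} {t : SeqOfRecord F θ.ν θ.τ9.M (gOfRecord₁₃Chi F N θ.toStage13Params χ p) p.K k → Sect2.TermValues (F.P p.K) (MatA N) (FluctV N) θ.τ9.M} {tnew : SeqOfRecord F θ.ν θ.τ9.M (gOfRecord₁₃Chi F N θ.toStage13Params χ p) p.K (k + 1) → Sect2.TermValues (F.P p.K) (MatA N) (FluctV N) θ.τ9.M}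
    (hu : Sect2.UniversalE t) (huN : Sect2.UniversalE tnew) : Sect2.UniversalE (spliceTermsB θ χ p k t tnew) :=
  universalE_graftAbove hu huN k (fun s => s.init) _ (spliceTermsB_E t tnew)

/-- **THE SPLICE IS `(k+1)`-LOCAL IN THE FLUCTUATION VARIABLES** when the old witness is `k`-local and the supplier's new terms are `(k+1)`-local (dag-n11-d's
`IsFluctLocal`: only the `𝐁`-components read the fluctuation datum; the splice's `𝐁^{(j)}` is the old one, the supplier's, or zero). [cite: Balaban1988Convergent, (2.40)–(2.41) p.261, (3.24) p.270 (bookkeeping)] -/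
theorem isFluctLocal_spliceTermsB {k : ℕ} {t : SeqOfRecord F θ.ν θ.τ9.M (gOfRecord₁₃Chi F N θ.toStage13Params χ p) p.K k → Sect2.TermValues (F.P p.K) (MatA N) (FluctV N) θ.τ9.M} {tnew : SeqOfRecord F θ.ν θ.τ9.M (gOfRecord₁₃Chi F N θ.toStage13Params χ p) p.K (k + 1) → Sect2.TermValues (F.P p.K) (MatA N) (FluctV N) θ.τ9.M}
    (s : SeqOfRecord F θ.ν θ.τ9.M (gOfRecord₁₃Chi F N θ.toStage13Params χ p) p.K (k + 1)) (ht : IsFluctLocal k (t s.init)) (hn : IsFluctLocal (k + 1) (tnew s)) :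
    IsFluctLocal (k + 1) (spliceTermsB θ χ p k t tnew s) := by
  classical
  have ht' := ht.mono (Nat.le_succ k)
  refine ⟨fun j X u S a a' ha => ?_⟩
  unfold spliceTermsB
  split_ifs with hΩ h0
  · show (if j ≤ k then (t s.init).B j X u (S, a) else (zeroRB (tnew s)).B j X u (S, a)) =
      (if j ≤ k then (t s.init).B j X u (S, a') else (zeroRB (tnew s)).B j X u (S, a'))
    split_ifs with hj
    · exact ht'.B_congr j X u S a a' ha
    · rfl
  · show (if j ≤ k then (dropBFrom k (t s.init)).B j X u (S, a) else (zeroRB (tnew s)).B j X u (S, a)) =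
      (if j ≤ k then (dropBFrom k (t s.init)).B j X u (S, a') else (zeroRB (tnew s)).B j X u (S, a'))
    split_ifs with hj
    · show (if j < k then (t s.init).B j X u (S, a) else 0) = (if j < k then (t s.init).B j X u (S, a') else 0)
      split_ifs with hj'
      · exact ht'.B_congr j X u S a a' ha
      · rfl
    · rfl
  · show (if j < k then (t s.init).B j X u (S, a) else (tnew s).B j X u (S, a)) =
      (if j < k then (t s.init).B j X u (S, a') else (tnew s).B j X u (S, a'))
    split_ifs with hj
    · exact ht'.B_congr j X u S a a' ha
    · exact hn.B_congr j X u S a a' ha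

/-- At a no-expansion history the spliced constant is the old one. [cite: Balaban1988Convergent, (3.25) p.270 (bookkeeping)] -/
theorem spliceConst_of_Omega_empty {k : ℕ} (Ek : SeqOfRecord F θ.ν θ.τ9.M (gOfRecord₁₃Chi F N θ.toStage13Params χ p) p.K k → ℝ) (EkN : SeqOfRecord F θ.ν θ.τ9.M (gOfRecord₁₃Chi F N θ.toStage13Params χ p) p.K (k + 1) → ℝ) (s : SeqOfRecord F θ.ν θ.τ9.M (gOfRecord₁₃Chi F N θ.toStage13Params χ p) p.K (k + 1)) (hΩ : s.Ω (k + 1) = ∅) :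
    spliceConst θ χ p k Ek EkN s = Ek s.init := by
  unfold spliceConst; rw [if_pos hΩ]

/-- At an expansion history the spliced constant is the supplier's. [cite: Balaban1988Convergent, (2.23) p.258 (bookkeeping)] -/
theorem spliceConst_of_Omega_ne {k : ℕ} (Ek : SeqOfRecord F θ.ν θ.τ9.M (gOfRecord₁₃Chi F N θ.toStage13Params χ p) p.K k → ℝ) (EkN : SeqOfRecord F θ.ν θ.τ9.M (gOfRecord₁₃Chi F N θ.toStage13Params χ p) p.K (k + 1) → ℝ) (s : SeqOfRecord F θ.ν θ.τ9.M (gOfRecord₁₃Chi F N θ.toStage13Params χ p) p.K (k + 1)) (hΩ : s.Ω (k + 1) ≠ ∅) :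
    spliceConst θ χ p k Ek EkN s = EkN s := by
  unfold spliceConst; rw [if_neg hΩ]

end Splice

/-! ## §2  Supplier functions, the base witness, the witness chain -/

section Chain

/-- **A SUPPLIER FUNCTION** for the run `p` at `θ`: at each level `k`, GIVEN a level-`k` witness `(t, E_k)` (term values and constants per history of length `k`), the new term
values `tnew` and constants `EkN` per history of length `k+1` — [III] §3's construction as a map on its own data.  A type; no property is attached here.
[cite: Balaban1988Convergent, §3 pp.264–265, §3 p.279 (bookkeeping)] -/
def Sect3Supplier : Type :=
  (k : ℕ) → (SeqOfRecord F θ.ν θ.τ9.M (gOfRecord₁₃Chi F N θ.toStage13Params χ p) p.K k → Sect2.TermValues (F.P p.K) (MatA N) (FluctV N) θ.τ9.M) → (SeqOfRecord F θ.ν θ.τ9.M (gOfRecord₁₃Chi F N θ.toStage13Params χ p) p.K k → ℝ) → (SeqOfRecord F θ.ν θ.τ9.M (gOfRecord₁₃Chi F N θ.toStage13Params χ p) p.K (k + 1) → Sect2.TermValues (F.P p.K) (MatA N) (FluctV N) θ.τ9.M) × (SeqOfRecord F θ.ν θ.τ9.M (gOfRecord₁₃Chi F N θ.toStage13Params χ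 p) p.K (k + 1) → ℝ)

/-- **THE LEVEL-0 WITNESS** of `ρ₀`'s §2 form at `θ`, `0`-LOCAL in the fluctuation variables — def-T's `sLaw₁₃CoPH_zero_chi` (whose proof exhibits zero term values and
the constant `E p`) unfolded by dag-n11-d's `sLaw₁₃CoPH_iff_exists_local` (form ∧ `IsFluctLocal 0`) and read by choice; nothing above level `0` ever reads level-`0` term values
(the sums (2.25)∕(2.30)∕(2.40) start at `j = 1`). [cite: Balaban1988Convergent, Thm 1 p.262, (2.23) p.258 (bookkeeping)] -/
def baseWitness : (SeqOfRecord F θ.ν θ.τ9.M (gOfRecord₁₃Chi F N θ.toStage13Params χ p) p.K 0 → Sect2.TermValues (F.P p.K) (MatA N) (FluctV N) θ.τ9.M) × (SeqOfRecord F θ.ν θ.τ9.M (gOfRecord₁₃Chi F N θ.toStage13Params χ p) p.K 0 → ℝ) :=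
  ⟨Classical.choose ((sLaw₁₃CoPH_iff_exists_local θ χ p 0).mp (sLaw₁₃CoPH_zero_chi F N θ χ p)),
    Classical.choose (Classical.choose_spec ((sLaw₁₃CoPH_iff_exists_local θ χ p 0).mp (sLaw₁₃CoPH_zero_chi F N θ χ p)))⟩

/-- The level-0 witness HAS the §2 form of `ρ₀` (def-T's theorem, read at the chosen witness). [cite: Balaban1988Convergent, Thm 1 p.262, (2.18) p.257] -/
theorem baseWitness_form :
    HasSect2FormAtZS F N (FluctV N) p.K (settingOfRecord₁₃Chi F N θ.toStage13Params χ p) 0 (θ.rzAtChi χ p) (WtOfRecord₁₃HChi F N θ χ p) (UbgOfRecord₁₃CoPChi F N θ.toStage13Params χ p 0)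
      (fun s u => Sect2.LawsRT (sect2TowerOfRecord F N (FluctV N) p.K (settingOfRecord₁₃Chi F N θ.toStage13Params χ p) (θ.rzAtChi χ p s) s u) (settingOfRecord₁₃Chi F N θ.toStage13Params χ p).lf 0)
      (slotsOfRecord F N θ.ν θ.τ9 (EOfRecord₁₃Chi F N θ.toStage13Params χ) (wOfRecord₉ F N θ.toStage9Params) θ.ppSel p (gOfRecord₁₃Chi F N θ.toStage13Params χ p) 0) (baseWitness θ χ p).1 (baseWitness θ χ p).2 :=
  (Classical.choose_spec (Classical.choose_spec ((sLaw₁₃CoPH_iff_exists_local θ χ p 0).mp (sLaw₁₃CoPH_zero_chi F N θ χ p)))).1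

/-- The level-0 witness is `0`-local in the fluctuation variables (dag-n11-d's `IsFluctLocal`). [cite: Balaban1988Convergent, (2.40)–(2.41) p.261 (bookkeeping)] -/
theorem isFluctLocal_baseWitness (s : SeqOfRecord F θ.ν θ.τ9.M (gOfRecord₁₃Chi F N θ.toStage13Params χ p) p.K 0) : IsFluctLocal 0 ((baseWitness θ χ p).1 s) :=
  (Classical.choose_spec (Classical.choose_spec ((sLaw₁₃CoPH_iff_exists_local θ χ p 0).mp (sLaw₁₃CoPH_zero_chi F N θ χ p)))).2 s

/-- **THE WITNESS CHAIN** of Theorem 1's induction driven by the supplier `σ`: level `0` = `baseWitness`; level `k+1` = the deterministic splice of the level-`k` witness with the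
supplier's response to it.  The §2 witness of `ρ_k` is thereby NAMED at every level: iterated splices of the suppliers' own terms (and zeros), i.e. print's «terms constructed so
far». [cite: Balaban1988Convergent, Thm 1 p.262, §3 p.279, (3.24)–(3.25) p.270 (bookkeeping)] -/
def chainWitness (σ : Sect3Supplier θ χ p) : (k : ℕ) → (SeqOfRecord F θ.ν θ.τ9.M (gOfRecord₁₃Chi F N θ.toStage13Params χ p) p.K k → Sect2.TermValues (F.P p.K) (MatA N) (FluctV N) θ.τ9.M) × (SeqOfRecord F θ.ν θ.τ9.M (gOfRecord₁₃Chi F N θ.toStage13Params χ p) p.K k → ℝ)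
  | 0 => baseWitness θ χ p
  | k + 1 =>
    ⟨spliceTermsB θ χ p k (chainWitness σ k).1 (σ k (chainWitness σ k).1 (chainWitness σ k).2).1,
      spliceConst θ χ p k (chainWitness σ k).2 (σ k (chainWitness σ k).1 (chainWitness σ k).2).2⟩

/-- **THE CHAIN WITNESS IS `k`-LOCAL AT EVERY LEVEL** when every supplier response is: level `0` by `isFluctLocal_baseWitness`, the step by `isFluctLocal_spliceTermsB` — so
dag-n11-d's witness-first faces (which ask `k`-locality of the witness) apply to THE CHAIN's witness. [cite: Balaban1988Convergent, (2.40)–(2.41) p.261, (3.24) p.270 (bookkeeping)] -/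
theorem isFluctLocal_chainWitness (σ : Sect3Supplier θ χ p)
    (hσ : ∀ k (s : SeqOfRecord F θ.ν θ.τ9.M (gOfRecord₁₃Chi F N θ.toStage13Params χ p) p.K (k + 1)), IsFluctLocal (k + 1) ((σ k (chainWitness θ χ p σ k).1 (chainWitness θ χ p σ k).2).1 s)) :
    ∀ k (s : SeqOfRecord F θ.ν θ.τ9.M (gOfRecord₁₃Chi F N θ.toStage13Params χ p) p.K k), IsFluctLocal k ((chainWitness θ χ p σ k).1 s) := by
  intro k
  induction k with
  | zero => exact fun s => isFluctLocal_baseWitness θ χ p s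
  | succ k ih => exact fun s => isFluctLocal_spliceTermsB s (ih s.init) (hσ k s)

end Chain

/-! ## §3  The per-level deliverables keyed to A GIVEN witness (predicates with parameters naming the shapes; nothing claimed) -/

section Deliverables

/-- **THE FOUR LEVEL-`(k+1)` 𝐄-CLAUSES for term values `u` on the tower of record along the history `s′`** — local dependence (2.27)(i), gauge invariance (2.27)(iii), the
IMPROVED bound of p. 262 and analyticity (2.27)(ii) of `𝐄^{(k+1)}`; history-free in substance (the 𝐄-space reads `bgI` only), stated along `s′` for convenience.
[cite: Balaban1988Convergent, (2.27)–(2.28) p.259, §2 p.262 (bookkeeping)] -/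
def NewEClausesAt (k : ℕ) (u : Sect2.TermValues (F.P p.K) (MatA N) (FluctV N) θ.τ9.M) (s : SeqOfRecord F θ.ν θ.τ9.M (gOfRecord₁₃Chi F N θ.toStage13Params χ p) p.K (k + 1)) : Prop :=
  (∀ X z g φ ψ, (sect2TowerOfRecord F N (FluctV N) p.K (settingOfRecord₁₃Chi F N θ.toStage13Params χ p) (θ.rzAtChi χ p s) s u).agreeOn (k + 1) X φ ψ → u.E (k + 1) X z g φ = u.E (k + 1) X z g ψ) ∧
  (∀ X z g v φ, u.E (k + 1) X z g ((sect2TowerOfRecord F N (FluctV N) p.K (settingOfRecord₁₃Chi F N θ.toStage13Params χ p) (θ.rzAtChi χ p s) s u).act v φ) = u.E (k + 1) X z g φ) ∧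
  (∀ X z g φ, 0 ≤ g → g ≤ (settingOfRecord₁₃Chi F N θ.toStage13Params χ p).lf.γ →
    φ ∈ (sect2TowerOfRecord F N (FluctV N) p.K (settingOfRecord₁₃Chi F N θ.toStage13Params χ p) (θ.rzAtChi χ p s) s u).space (k + 1) X ((settingOfRecord₁₃Chi F N θ.toStage13Params χ p).lf.alpha0 ((settingOfRecord₁₃Chi F N θ.toStage13Params χ p).flow.g (k + 1))) ((settingOfRecord₁₃Chi F N θ.toStage13Params χ p).lf.alpha1 ((settingOfRecord₁₃Chi F N θ.toStage13Params χ p).flow.g (k + 1))) →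
      ‖u.E (k + 1) X z g φ‖ ≤ (settingOfRecord₁₃Chi F N θ.toStage13Params χ p).lf.E₀ * Real.exp (-((1 + 4 * (settingOfRecord₁₃Chi F N θ.toStage13Params χ p).βc) * (settingOfRecord₁₃Chi F N θ.toStage13Params χ p).lf.κ) * (Sect2.domSys (F.P p.K) θ.τ9.M (k + 1)).dj X)) ∧
  (∀ X z g, 0 ≤ g → g ≤ (settingOfRecord₁₃Chi F N θ.toStage13Params χ p).lf.γ →
    AnalyticOnNhd ℂ (u.E (k + 1) X z g)
      ((sect2TowerOfRecord F N (FluctV N) p.K (settingOfRecord₁₃Chi F N θ.toStage13Params χ p) (θ.rzAtChi χ p s) s u).space (k + 1) X ((settingOfRecord₁₃Chi F N θ.toStage13Params χ p).lf.alpha0 ((settingOfRecord₁₃Chi F N θ.toStage13Params χ p).flow.g (k + 1))) ((settingOfRecord₁₃Chi F N θ.toStage13Params χ p).lf.alpha1 ((settingOfRecord₁₃Chi F N θ.toStage13Params χ p).flow.g (k + 1)))))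

/-- **THE OBLIGATIONS AT A 𝐓-PRESENT EXPANSION CHILD `s′` FOR A GIVEN level-`k` witness `t` and the supplier's response `(tnew, EkN)`** — (O1′) the supplier's own `𝐁^{(k)}` on the
child's `Ũ^c_k(X)` (void at `k = 0`), (O2) r11's new-term obligations + analyticity at `k+1`, (O3′) the 𝐓-image identity ((3.24)–(3.25) p.270, §3 p.279) for
`graftAboveB k (t (init s′)) (tnew s′)` with the constant `EkN s′` — the body of `…SpliceOwnBoundary`'s label-keyed supply, per child.
[cite: Balaban1988Convergent, Thm 2 p.263, §3 p.279, (3.24)–(3.25) p.270, (2.27)–(2.31) pp.259–260, (2.38)–(2.42) p.261] -/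
def PresentChildObligations (k : ℕ) (t : SeqOfRecord F θ.ν θ.τ9.M (gOfRecord₁₃Chi F N θ.toStage13Params χ p) p.K k → Sect2.TermValues (F.P p.K) (MatA N) (FluctV N) θ.τ9.M) (tnew : SeqOfRecord F θ.ν θ.τ9.M (gOfRecord₁₃Chi F N θ.toStage13Params χ p) p.K (k + 1) → Sect2.TermValues (F.P p.K) (MatA N) (FluctV N) θ.τ9.M)
    (EkN : SeqOfRecord F θ.ν θ.τ9.M (gOfRecord₁₃Chi F N θ.toStage13Params χ p) p.K (k + 1) → ℝ) (s : SeqOfRecord F θ.ν θ.τ9.M (gOfRecord₁₃Chi F N θ.toStage13Params χ p) p.K (k + 1)) : Prop :=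
  -- (O1′) the supplier's OWN level-`k` boundary term on the child's space `Ũ^c_k(X)`
  (1 ≤ k →
    (∀ (X : (Sect2.domSys (F.P p.K) θ.τ9.M k).Dom) (φ : Sect2.CPair (F.P p.K) (MatA N)) (a : SFluct (F.P p.K) (FluctV N)),
      φ ∈ (sect2TowerOfRecord F N (FluctV N) p.K (settingOfRecord₁₃Chi F N θ.toStage13Params χ p) (θ.rzAtChi χ p s) s (tnew s)).spaceB k X →
        ‖(tnew s).B k X φ a‖ ≤ (settingOfRecord₁₃Chi F N θ.toStage13Params χ p).lf.B₀ * Real.exp (-(settingOfRecord₁₃Chi F N θ.toStage13Params χ p).lf.κ * (Sect2.domSys (F.P p.K) θ.τ9.M k).dj X)) ∧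
    (∀ (X : (Sect2.domSys (F.P p.K) θ.τ9.M k).Dom) (a : SFluct (F.P p.K) (FluctV N)),
      AnalyticOnNhd ℂ (fun φ => (tnew s).B k X φ a)
        ((sect2TowerOfRecord F N (FluctV N) p.K (settingOfRecord₁₃Chi F N θ.toStage13Params χ p) (θ.rzAtChi χ p s) s (tnew s)).spaceB k X))) ∧
  -- (O2) the new terms: r11's new-term obligations and analyticity at `k+1`
  Step.LFNewTerms (sect2TowerOfRecord F N (FluctV N) p.K (settingOfRecord₁₃Chi F N θ.toStage13Params χ p) (θ.rzAtChi χ p s) s (tnew s))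
    (settingOfRecord₁₃Chi F N θ.toStage13Params χ p).lf (settingOfRecord₁₃Chi F N θ.toStage13Params χ p).βc k ∧
  (∀ (X : (Sect2.domSys (F.P p.K) θ.τ9.M (k + 1)).Dom) (z : Site (F.P p.K) (k + 1)) (g : ℝ), 0 ≤ g → g ≤ (settingOfRecord₁₃Chi F N θ.toStage13Params χ p).lf.γ →
    AnalyticOnNhd ℂ ((tnew s).E (k + 1) X z g)
      ((sect2TowerOfRecord F N (FluctV N) p.K (settingOfRecord₁₃Chi F N θ.toStage13Params χ p) (θ.rzAtChi χ p s) s (tnew s)).space (k + 1) X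
        ((settingOfRecord₁₃Chi F N θ.toStage13Params χ p).lf.alpha0 ((settingOfRecord₁₃Chi F N θ.toStage13Params χ p).flow.g (k + 1)))
        ((settingOfRecord₁₃Chi F N θ.toStage13Params χ p).lf.alpha1 ((settingOfRecord₁₃Chi F N θ.toStage13Params χ p).flow.g (k + 1))))) ∧
  (∀ X : (Sect2.domSys (F.P p.K) θ.τ9.M (k + 1)).Dom,
    AnalyticOnNhd ℂ ((tnew s).R (k + 1) X)
      ((sect2TowerOfRecord F N (FluctV N) p.K (settingOfRecord₁₃Chi F N θ.toStage13Params χ p) (θ.rzAtChi χ p s) s (tnew s)).space (k + 1) X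
        ((settingOfRecord₁₃Chi F N θ.toStage13Params χ p).lf.alpha0 ((settingOfRecord₁₃Chi F N θ.toStage13Params χ p).flow.g (k + 1)))
        ((settingOfRecord₁₃Chi F N θ.toStage13Params χ p).lf.alpha1 ((settingOfRecord₁₃Chi F N θ.toStage13Params χ p).flow.g (k + 1))))) ∧
  (∀ (X : (Sect2.domSys (F.P p.K) θ.τ9.M (k + 1)).Dom) (a : SFluct (F.P p.K) (FluctV N)),
    AnalyticOnNhd ℂ (fun φ => (tnew s).B (k + 1) X φ a)
      ((sect2TowerOfRecord F N (FluctV N) p.K (settingOfRecord₁₃Chi F N θ.toStage13Params χ p) (θ.rzAtChi χ p s) s (tnew s)).spaceB (k + 1) X)) ∧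
  -- (O3′) the 𝐓-image clause for the spliced witness with the supplier's own `𝐁^{(k)}`
  (slotsTOfRecord F N θ.ν θ.τ9 (EOfRecord₁₃Chi F N θ.toStage13Params χ) (wOfRecord₉ F N θ.toStage9Params) θ.ppSel p
      (gOfRecord₁₃Chi F N θ.toStage13Params χ p) (k + 1) s = 0 ∨
    ∀ᵐ V' ∂fieldMeasure (F.P p.K) (k + 1) (SU N),
      chiSeqOfRecord F N θ.ν θ.τ9.M (gOfRecord₁₃Chi F N θ.toStage13Params χ p) p.K (k + 1) s V' ≠ 0 →
        slotsTOfRecord F N θ.ν θ.τ9 (EOfRecord₁₃Chi F N θ.toStage13Params χ) (wOfRecord₉ F N θ.toStage9Params) θ.ppSel p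
            (gOfRecord₁₃Chi F N θ.toStage13Params χ p) (k + 1) s V' =
          sect2Slot F N (FluctV N) p.K (settingOfRecord₁₃Chi F N θ.toStage13Params χ p) (θ.rzAtChi χ p s) (WtOfRecord₁₃HChi F N θ χ p s) s
            (graftAboveB k (t s.init) (tnew s)) (EkN s) (UbgOfRecord₁₃CoPChi F N θ.toStage13Params χ p (k + 1) s) V')

/-- **dag-n11-d's NO-EXPANSION 𝐓-CLAUSE FOR A GIVEN level-`k` witness `(t, E_k)`**: at every no-expansion history `s′` (`Ω_{k+1}(s′) = ∅`) the 𝐓-image clause for the old terms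
`(t (init s′), E_k(init s′))` — the conclusion of `NoExpansionTStepAt θ p k` for THIS witness (their witness-first faces conclude exactly this for a `k`-local witness).
[cite: Balaban1988Convergent, Theorem p.245, (3.24)–(3.25) p.270, (2.17)–(2.18) p.257] -/
def NoExpansionClauseFor (k : ℕ) (t : SeqOfRecord F θ.ν θ.τ9.M (gOfRecord₁₃Chi F N θ.toStage13Params χ p) p.K k → Sect2.TermValues (F.P p.K) (MatA N) (FluctV N) θ.τ9.M) (Ek : SeqOfRecord F θ.ν θ.τ9.M (gOfRecord₁₃Chi F N θ.toStage13Params χ p) p.K k → ℝ) : Prop :=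
  ∀ s : SeqOfRecord F θ.ν θ.τ9.M (gOfRecord₁₃Chi F N θ.toStage13Params χ p) p.K (k + 1), s.Ω (k + 1) = ∅ →
    slotsTOfRecord F N θ.ν θ.τ9 (EOfRecord₁₃Chi F N θ.toStage13Params χ) (wOfRecord₉ F N θ.toStage9Params) θ.ppSel p (gOfRecord₁₃Chi F N θ.toStage13Params χ p) (k + 1) s = 0 ∨
      ∀ᵐ V' ∂fieldMeasure (F.P p.K) (k + 1) (SU N),
        chiSeqOfRecord F N θ.ν θ.τ9.M (gOfRecord₁₃Chi F N θ.toStage13Params χ p) p.K (k + 1) s V' ≠ 0 →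
          slotsTOfRecord F N θ.ν θ.τ9 (EOfRecord₁₃Chi F N θ.toStage13Params χ) (wOfRecord₉ F N θ.toStage9Params) θ.ppSel p (gOfRecord₁₃Chi F N θ.toStage13Params χ p) (k + 1) s V' =
            sect2Slot F N (FluctV N) p.K (settingOfRecord₁₃Chi F N θ.toStage13Params χ p) (θ.rzAtChi χ p s) (WtOfRecord₁₃HChi F N θ χ p s) s (t s.init) (Ek s.init)
              (UbgOfRecord₁₃CoPChi F N θ.toStage13Params χ p (k + 1) s) V'

end Deliverables

end Summit.QuantumFields.YangMills.Theorems.BalabanUVNodesN11Sect3SupplyChainDefsChi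

end

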